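import Summits.KontsevichZagierPeriods.KontsevichZagierPeriods.Theorems.RootDecompQuadraticDescentGoldenPairP3

/-!
# DARK census pair #10 `[□²,1/(1−x+y+x²−y²)] ≡ 2·[□²,1/(1+y+2xy+y²)]` DECIDED in `KZ.relations` by rules 1+2 (route `RootDecompQuadraticDescent`, instance of crux stmt-KontsevichZagierPeriods-28994 `DescentTwoQ` / stmt-4280 `KZDimTwo`) · part 4/6

Cell `decomp-kz`, lens 6 (decomp-kz-lens-6 g8e): `pair10` — the golden-ratio dilogarithm pair of the weight-2 box census, decided with ℚ-data only (no power map, no Landen, no irrational cut); packaged `goldenPair_descentTwoQ_instance` (∀ R ⊇ relations) and `goldenPair_of_kzDimTwo` BY NAME over the born `KZDimTwo`; imports the LANDED `…DarkPairsEleven` reflection kit.  After this, the weight-2 box census has ONE open row (#18).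

Source: `HOME/decomp-kz-lens-6/g8/GoldenPair10.lean` sha256 3ad60a9384e30dab (1472 l; critic decomp-kz-crit-1 g2 CLEARED/kernel-confirmed 2026-08-30T10:32:33Z, std axioms), split into 6 modules by the landing seat decomp-kz-census-1 g7 (contexts re-opened per part; generic docstrings added where the source had none; the route file is imported only by the last part).  No `sorry`; standard axioms.  References: [cite: KontsevichZagier2001, §1.2].
-/

noncomputable section

open MeasureTheory Set MvPolynomial

namespace Summit.KontsevichZagierPeriods.RootDecompQuadraticDescent.GoldenPair

open Literature.NumberTheory.Transcendental
open Literature.NumberTheory.Transcendental.KZ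
open Literature.ModelTheory.ExponentialFields (IsSemialgebraic continuous_aeval_real)
open Summit.KontsevichZagierPeriods.RootDecompQuadraticDescent.DarkPairs (rel_reflect_rep rel_double
  update_one_apply_zero one_div_eq_mul_one_div)

-- PRIVATE copy (landed twin elsewhere; dedup.landed): volume_vline
/-- The line `{t = q}` in `ℝ²` is null. -/
private theorem volume_vline (q : ℝ) : volume {z : Fin 2 → ℝ | z 0 = q} = 0 :=
  measure_mono_null (fun _ hz => hz)
    (KZ.volume_setOf_init_mem_eq_zero (n := 1) (KZ.volume_setOf_last_eq_zero (n := 0) q))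

-- PRIVATE copy (landed twin elsewhere; dedup.landed): snoc2_zero, snoc2_one, init2_zero, rel_trans
/-- `snoc2_zero`: auxiliary theorem of the lens-6 g8e development GoldenPair10 (census pair #10; instances of 28994/4280) — see the module docstring; verbatim from the lens file. -/
@[simp] private theorem snoc2_zero (x : Fin 1 → ℝ) (t : ℝ) : (Fin.snoc x t : Fin 2 → ℝ) 0 = x 0 := rfl

/-- `snoc2_one`: auxiliary theorem of the lens-6 g8e development GoldenPair10 (census pair #10; instances of 28994/4280) — see the module docstring; verbatim from the lens file. -/
@[simp] private theorem snoc2_one (x : Fin 1 → ℝ) (t : ℝ) : (Fin.snoc x t : Fin 2 → ℝ) 1 = t := rfl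

/-- `init2_zero`: auxiliary theorem of the lens-6 g8e development GoldenPair10 (census pair #10; instances of 28994/4280) — see the module docstring; verbatim from the lens file. -/
@[simp] private theorem init2_zero (z : Fin 2 → ℝ) : Fin.init z 0 = z 0 := rfl

/-- `rel_trans`: auxiliary theorem of the lens-6 g8e development GoldenPair10 (census pair #10; instances of 28994/4280) — see the module docstring; verbatim from the lens file. -/
private theorem rel_trans {a b c : KZ.FormalRep} (h₁ : a - b ∈ KZ.relations) (h₂ : b - c ∈ KZ.relations) :
    a - c ∈ KZ.relations := by
  have h := add_mem h₁ h₂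
  rwa [sub_add_sub_cancel] at h

/-- `QB10_pos`: auxiliary theorem of the lens-6 g8e development GoldenPair10 (census pair #10; instances of 28994/4280) — see the module docstring; verbatim from the lens file. -/
theorem QB10_pos {x : Fin 2 → ℝ} (hx : x ∈ cube 2) : 0 < aeval x QB10 := by
  have h0 := (hx 0).1; have h1 := (hx 1).1
  simp only [QB10, map_add, map_mul, map_pow, map_ofNat, map_one, aeval_X]; positivity
/-- `QB10s_pos`: auxiliary theorem of the lens-6 g8e development GoldenPair10 (census pair #10; instances of 28994/4280) — see the module docstring; verbatim from the lens file. -/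
private theorem QB10s_pos {x : Fin 2 → ℝ} (hx : x ∈ cube 2) : 0 < aeval x QB10s := by
  have h0 := (hx 0).1; have h1 := (hx 1).1
  simp only [QB10s, map_add, map_mul, map_pow, map_ofNat, map_one, aeval_X]; positivity
/-- `QW_pos`: auxiliary theorem of the lens-6 g8e development GoldenPair10 (census pair #10; instances of 28994/4280) — see the module docstring; verbatim from the lens file. -/
private theorem QW_pos {x : Fin 2 → ℝ} (hx : x ∈ cube 2) : 0 < aeval x QW := by
  have h0 := (hx 0).1; have h1 := (hx 1).1
  simp only [QW, map_add, map_mul, map_pow, map_one, aeval_X]; positivity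
/-- `QW_ge`: auxiliary theorem of the lens-6 g8e development GoldenPair10 (census pair #10; instances of 28994/4280) — see the module docstring; verbatim from the lens file. -/
private theorem QW_ge {z : Fin 2 → ℝ} (hz : z ∈ sbDom zeroE oneE.onePlus) : (1 : ℝ) ≤ aeval z QW := by
  obtain ⟨⟨h0, h0'⟩, h1, h2⟩ := mem_sbDom.1 hz
  simp only [zeroE_f] at h1
  simp only [QW, map_add, map_mul, map_pow, map_one, aeval_X]; nlinarith [mul_nonneg h0 h1]

/-- `B10`: auxiliary def of the lens-6 g8e development GoldenPair10 (census pair #10; instances of 28994/4280) — see the module docstring; verbatim from the lens file. -/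
def B10 : RFun 2 := ⟨1, QB10, fun _ hx => (QB10_pos hx).ne'⟩
/-- `B10s`: auxiliary def of the lens-6 g8e development GoldenPair10 (census pair #10; instances of 28994/4280) — see the module docstring; verbatim from the lens file. -/
def B10s : RFun 2 := ⟨1, QB10s, fun _ hx => (QB10s_pos hx).ne'⟩
/-- `B10two`: auxiliary def of the lens-6 g8e development GoldenPair10 (census pair #10; instances of 28994/4280) — see the module docstring; verbatim from the lens file. -/
def B10two : RFun 2 := ⟨2, QB10s, fun _ hx => (QB10s_pos hx).ne'⟩
/-- `Gmr`: auxiliary def of the lens-6 g8e development GoldenPair10 (census pair #10; instances of 28994/4280) — see the module docstring; verbatim from the lens file. -/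
def Gmr : RFun 2 := ⟨1, QW, fun _ hx => (QW_pos hx).ne'⟩
/-- `W = [{0 ≤ s ≤ 2}, du ds/(1 + u + u² + u s)]`. -/
def W : KZ.IntegralRep 2 :=
  BRq zeroE oneE.onePlus 1 QW 1 1 one_pos (fun _ hz => QW_ge hz) fun z _ => abs_aeval_one_le z

/-- (b1) swap `x ↔ y`: `B10 ≡ B10s`. -/
theorem b1 : KZ.of B10.rep - KZ.of B10s.rep ∈ KZ.relations := by
  have h1 := RFun.rel_rename B10 (Equiv.swap 0 1)
  have h2 : KZ.of (B10.rename (Equiv.swap 0 1)).rep - KZ.of B10s.rep ∈ KZ.relations :=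
    RFun.rel_of_eqOn fun z _ => by
      rw [RFun.fn_rename]
      simp only [RFun.fn, B10, B10s, QB10, QB10s, map_add, map_mul, map_pow, map_ofNat, map_one,
        aeval_X, Function.comp_apply, Equiv.swap_apply_left, Equiv.swap_apply_right]
      ring
  exact rel_trans h1 h2

/-- (b2) doubling (rule 1b): `B10two ≡ 2·B10s`. -/
private theorem b2 : KZ.of B10two.rep - 2 • KZ.of B10s.rep ∈ KZ.relations :=
  rel_double B10s B10two fun x _ => by
    simp only [RFun.fn, B10two, B10s, map_ofNat, map_one]; ring

/-- (b3) fibre dilation `σ = s/2`: `W ≡ B10two`. -/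
theorem b3 : KZ.of W - KZ.of B10two.rep ∈ KZ.relations := by
  refine of_sub_of_mem_relations_of_fibreMap (G := ivl 0 1) (a := fun y => zeroE.f (y 0))
    (b := fun y => oneE.onePlus.f (y 0)) (a' := fun _ => (0 : ℝ)) (b' := fun _ => (1 : ℝ))
    (fun z => z 1 / 2) (fun _ => (1 / 2 : ℝ)) W B10two.rep rfl (by rw [RFun.rep_domain, cube_eq_band])
    (fun y _ => by simp) ?_ ?_ ?_ ?_ ?_ ?_ ?_
  · exact (isSemialgebraicFunOn_aeval_div_aeval W.isSemialgebraic_domain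
      (X 1 : MvPolynomial (Fin 2) ℚ) 2 fun z _ => by simp).congr fun z _ => by simp
  · intro z _; fun_prop
  · intro z _
    show HasDerivAt (fun t => (Fin.snoc (Fin.init z) t : Fin 2 → ℝ) 1 / 2) _ (z 1)
    simp only [snoc2_one]
    exact ((hasDerivAt_id' (z 1)).div_const 2).congr_deriv (by ring)
  · intro z _; norm_num
  · intro y _
    show (Fin.snoc y (zeroE.f (y 0)) : Fin 2 → ℝ) 1 / 2 = 0
    simp
  · intro y _
    show (Fin.snoc y (oneE.onePlus.f (y 0)) : Fin 2 → ℝ) 1 / 2 = 1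
    simp only [snoc2_one, Edge.onePlus_f, oneE_f]; norm_num
  · intro z hz
    have hz' : z ∈ sbDom zeroE oneE.onePlus := hz
    have hQ := QW_ge hz'
    obtain ⟨⟨h0, h0'⟩, h1, h2⟩ := mem_sbDom.1 hz'
    simp only [QW, map_add, map_mul, map_pow, map_one, aeval_X] at hQ
    rw [RFun.rep_integrand]
    simp only [W, BRq_integrand, RFun.fn, B10two, QB10s, QW, map_add, map_mul, map_pow, map_ofNat,
      map_one, aeval_X, snoc2_zero, snoc2_one, init2_zero]
    have hD : (1 : ℝ) + z 0 + z 0 ^ 2 + z 0 * z 1 ≠ 0 := by linarith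
    have hD' : (1 : ℝ) + z 0 + 2 * z 0 * (z 1 / 2) + z 0 ^ 2 ≠ 0 := by
      rw [show (1 : ℝ) + z 0 + 2 * z 0 * (z 1 / 2) + z 0 ^ 2 = 1 + z 0 + z 0 ^ 2 + z 0 * z 1 by ring]
      exact hD
    have hD2 : (1 : ℝ) + z 0 + z 0 * z 1 + z 0 ^ 2 ≠ 0 := by
      rw [show (1 : ℝ) + z 0 + z 0 * z 1 + z 0 ^ 2 = 1 + z 0 + z 0 ^ 2 + z 0 * z 1 by ring]
      exact hD
    field_simp
    try ring

/-- (b4) the cut at `s = 1`. -/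
private theorem b4 : KZ.of W - KZ.of (loP W zeroE oneE oneE.onePlus rfl fun _ _ => by simp) -
    KZ.of (hiP W zeroE oneE oneE.onePlus rfl fun _ _ => by simp) ∈ KZ.relations :=
  br_cut W zeroE oneE oneE.onePlus rfl (fun _ _ => by simp) fun _ _ => by simp

/-- (b5) the lower piece is `Gmr` on the square. -/
private theorem b5 : KZ.of (loP W zeroE oneE oneE.onePlus rfl fun _ _ => by simp) - KZ.of Gmr.rep ∈
    KZ.relations :=
  KZ.of_sub_of_mem_relations_of_eqOn (by rw [RFun.rep_domain, cube_eq_sbDom]; rfl) fun z _ => by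
    rw [loP_integrand, RFun.rep_integrand]
    simp only [W, BRq_integrand, RFun.fn, Gmr, map_one]

/-- (b6) fibre translation `s = 1 + σ`: `G(1) ≡` the upper piece. -/
theorem b6 : KZ.of (Gc 1 (by norm_num)).rep -
    KZ.of (hiP W zeroE oneE oneE.onePlus rfl fun _ _ => by simp) ∈ KZ.relations := by
  refine rel_shift oneE (Gc 1 (by norm_num)).rep _ (by rw [RFun.rep_domain, cube_eq_sbDom]) rfl
    fun z _ => ?_
  rw [RFun.rep_integrand, hiP_integrand]
  simp only [RFun.fn, Gc, QG, W, BRq_integrand, QW, map_add, map_mul, map_pow, map_one,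
    aeval_X, snoc2_zero, snoc2_one, init2_zero]
  ring

/-- (b7) fibre reflection `σ ↦ 1 − σ`: `G(−1) ≡ Gmr`. -/
private theorem b7 : KZ.of (Gc (-1) (by norm_num)).rep - KZ.of Gmr.rep ∈ KZ.relations := by
  refine rel_reflect_rep 2 1 (Gc (-1) (by norm_num)).rep Gmr.rep (RFun.isTameCube_rep _)
    (RFun.isTameCube_rep _) fun x _ => ?_
  rw [RFun.rep_integrand, RFun.rep_integrand]
  simp only [RFun.fn, Gc, Gmr, QG, QW, map_add, map_mul, map_pow, map_one, map_neg, aeval_X,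
    Function.update_self, update_one_apply_zero]
  ring

/-- **B-side**: `G(1) + G(−1) ≡ 2·B10`. -/
private theorem two_b10 : KZ.of (Gc 1 (by norm_num)).rep + KZ.of (Gc (-1) (by norm_num)).rep -
    2 • KZ.of B10.rep ∈ KZ.relations := by
  have hA : (2 : ℕ) • (KZ.of B10.rep - KZ.of B10s.rep) ∈ KZ.relations := AddSubgroup.nsmul_mem _ b1 2
  have h := add_mem (add_mem (sub_mem (sub_mem (add_mem (sub_mem b2 hA) b3) b4) b5) b6) b7
  convert h using 1
  simp only [smul_sub]
  abel

/-! ## §7 The golden heart: `T₊ + T₋ ≡ 2·B10` -/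

/-- **`[Δ, dw dv/(1 + wv)] + [Δ, dw dv/(1 − wv)] − 2·[B10] ∈ KZ.relations`** — the dark row #10 up to the
elementary dissection `A10 ≡ T₊ + T₋` of the square along its two diagonals (plan P8, gen 9). -/
theorem golden_heart : KZ.of (TΔ 1 (by norm_num)) + KZ.of (TΔ (-1) (by norm_num)) -
    2 • KZ.of B10.rep ∈ KZ.relations := by
  have h := add_mem (add_mem two_b10 (tΔ_G 1 (by norm_num))) (tΔ_G (-1) (by norm_num))
  convert h using 1
  abel

/-! ## §8 The A-side: `A10 ≡ T₊ + T₋` by dissecting the square along its two diagonals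

`Q_A = 1 − x + y + x² − y² = 1 + (x − y)(x + y − 1)`.  In the coordinates `p = x − y`, `q = x + y − 1`
the square is the diamond `|p| + |q| ≤ 1`; its four quadrants are the triangles below / above both
diagonals (`pq ≤ 0`) and left / right of both (`pq ≥ 0`), each mapped linearly (`|det| = 2`) onto
`Δ`, where the integrand becomes `1/(2(1 ∓ wv))`. -/

/-! ### min / max edges and base cuts of general bands -/

/-- `sa_min`: auxiliary theorem of the lens-6 g8e development GoldenPair10 (census pair #10; instances of 28994/4280) — see the module docstring; verbatim from the lens file. -/
theorem sa_min (E F : Edge) :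
    IsSemialgebraicFunOn ℚ (ivl 0 1) (fun y => min (E.f (y 0)) (F.f (y 0))) := by
  have h := IsSemialgebraicFunOn.mul_holds (isSemialgebraicFunOn_ratCast (isSemialgebraic_ivl 0 1) (1 / 2))
    (IsSemialgebraicFunOn.sub_holds (IsSemialgebraicFunOn.add_holds E.sa F.sa)
      (IsSemialgebraicFunOn.sub_holds E.sa F.sa).abs)
  refine h.congr fun y _ => ?_
  try simp only [Pi.mul_apply, Pi.sub_apply, Pi.add_apply]
  rcases le_total (E.f (y 0)) (F.f (y 0)) with hle | hle
  · rw [min_eq_left hle, abs_of_nonpos (by linarith)]; push_cast; ring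
  · rw [min_eq_right hle, abs_of_nonneg (by linarith)]; push_cast; ring

/-- `sa_max`: auxiliary theorem of the lens-6 g8e development GoldenPair10 (census pair #10; instances of 28994/4280) — see the module docstring; verbatim from the lens file. -/
theorem sa_max (E F : Edge) :
    IsSemialgebraicFunOn ℚ (ivl 0 1) (fun y => max (E.f (y 0)) (F.f (y 0))) := by
  have h := IsSemialgebraicFunOn.mul_holds (isSemialgebraicFunOn_ratCast (isSemialgebraic_ivl 0 1) (1 / 2))
    (IsSemialgebraicFunOn.add_holds (IsSemialgebraicFunOn.add_holds E.sa F.sa)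
      (IsSemialgebraicFunOn.sub_holds E.sa F.sa).abs)
  refine h.congr fun y _ => ?_
  try simp only [Pi.mul_apply, Pi.sub_apply, Pi.add_apply]
  rcases le_total (E.f (y 0)) (F.f (y 0)) with hle | hle
  · rw [max_eq_right hle, abs_of_nonpos (by linarith)]; push_cast; ring
  · rw [max_eq_left hle, abs_of_nonneg (by linarith)]; push_cast; ring

/-- Pointwise `min` / `max` of two edges. -/
def minE (E F : Edge) : Edge :=
  ⟨fun t => min (E.f t) (F.f t), sa_min E F, fun t ht => le_min (E.nonneg t ht) (F.nonneg t ht), by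
    have h := ((E.cont.add F.cont).sub (continuous_abs.comp_continuousOn (E.cont.sub F.cont))).div_const 2
    refine h.congr fun t _ => ?_
    simp only [Pi.add_apply, Pi.sub_apply, Function.comp_apply]
    rcases le_total (E.f t) (F.f t) with hle | hle
    · rw [min_eq_left hle, abs_of_nonpos (by linarith)]; ring
    · rw [min_eq_right hle, abs_of_nonneg (by linarith)]; ring⟩
/-- `maxE`: auxiliary def of the lens-6 g8e development GoldenPair10 (census pair #10; instances of 28994/4280) — see the module docstring; verbatim from the lens file. -/
def maxE (E F : Edge) : Edge :=
  ⟨fun t => max (E.f t) (F.f t), sa_max E F, fun t ht => (E.nonneg t ht).trans (le_max_left _ _), by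
    have h := ((E.cont.add F.cont).add (continuous_abs.comp_continuousOn (E.cont.sub F.cont))).div_const 2
    refine h.congr fun t _ => ?_
    simp only [Pi.add_apply, Pi.sub_apply, Function.comp_apply]
    rcases le_total (E.f t) (F.f t) with hle | hle
    · rw [max_eq_right hle, abs_of_nonpos (by linarith)]; ring
    · rw [max_eq_left hle, abs_of_nonneg (by linarith)]; ring⟩
/-- `minE_f`: auxiliary theorem of the lens-6 g8e development GoldenPair10 (census pair #10; instances of 28994/4280) — see the module docstring; verbatim from the lens file. -/
@[simp] private theorem minE_f (E F : Edge) (t : ℝ) : (minE E F).f t = min (E.f t) (F.f t) := rfl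
/-- `maxE_f`: auxiliary theorem of the lens-6 g8e development GoldenPair10 (census pair #10; instances of 28994/4280) — see the module docstring; verbatim from the lens file. -/
@[simp] private theorem maxE_f (E F : Edge) (t : ℝ) : (maxE E F).f t = max (E.f t) (F.f t) := rfl

/-- The broken edges `min(x, 1 − x)` and `max(x, 1 − x)` (the two diagonals of the square, folded). -/
def mnE : Edge := minE idE omE
/-- `mxE`: auxiliary def of the lens-6 g8e development GoldenPair10 (census pair #10; instances of 28994/4280) — see the module docstring; verbatim from the lens file. -/
def mxE : Edge := maxE idE omE
/-- `mnE_f`: auxiliary theorem of the lens-6 g8e development GoldenPair10 (census pair #10; instances of 28994/4280) — see the module docstring; verbatim from the lens file. -/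
@[simp] theorem mnE_f (t : ℝ) : mnE.f t = min t (1 - t) := rfl
/-- `mxE_f`: auxiliary theorem of the lens-6 g8e development GoldenPair10 (census pair #10; instances of 28994/4280) — see the module docstring; verbatim from the lens file. -/
@[simp] theorem mxE_f (t : ℝ) : mxE.f t = max t (1 - t) := rfl

/-- The part of a general band over the base sub-interval `[lo, hi] ⊆ [0, 1]`. -/
def gband (lo hi : ℚ) (L U : Edge) : Set (Fin 2 → ℝ) :=
  KZlog.band (ivl lo hi) (fun y => L.f (y 0)) (fun y => U.f (y 0))

/-- `mem_gband`: auxiliary theorem of the lens-6 g8e development GoldenPair10 (census pair #10; instances of 28994/4280) — see the module docstring; verbatim from the lens file. -/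
theorem mem_gband {lo hi : ℚ} {L U : Edge} {z : Fin 2 → ℝ} :
    z ∈ gband lo hi L U ↔ ((lo : ℝ) ≤ z 0 ∧ z 0 ≤ hi) ∧ L.f (z 0) ≤ z 1 ∧ z 1 ≤ U.f (z 0) := by
  show (Fin.init z ∈ ivl lo hi ∧ L.f (Fin.init z 0) ≤ z (Fin.last 1) ∧ z (Fin.last 1) ≤ U.f (Fin.init z 0)) ↔ _
  rw [mem_ivl]
  rfl

/-- `isSemialgebraic_gband`: auxiliary theorem of the lens-6 g8e development GoldenPair10 (census pair #10; instances of 28994/4280) — see the module docstring; verbatim from the lens file. -/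
private theorem isSemialgebraic_gband (lo hi : ℚ) (hlo : 0 ≤ lo) (hhi : hi ≤ 1) (L U : Edge) :
    IsSemialgebraic ℚ (gband lo hi L U) :=
  KZlog.isSemialgebraic_band (L.sa.mono (ivl_subset hlo hhi) (isSemialgebraic_ivl lo hi))
    (U.sa.mono (ivl_subset hlo hhi) (isSemialgebraic_ivl lo hi))

/-- `gband_subset`: auxiliary theorem of the lens-6 g8e development GoldenPair10 (census pair #10; instances of 28994/4280) — see the module docstring; verbatim from the lens file. -/
theorem gband_subset (lo hi : ℚ) (hlo : 0 ≤ lo) (hhi : hi ≤ 1) (L U : Edge) :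
    gband lo hi L U ⊆ sbDom L U := fun z hz => by
  rw [mem_gband] at hz
  rw [mem_sbDom]
  have h1 : ((0 : ℚ) : ℝ) ≤ lo := by exact_mod_cast hlo
  have h2 : ((hi : ℚ) : ℝ) ≤ ((1 : ℚ) : ℝ) := by exact_mod_cast hhi
  push_cast at h1 h2
  exact ⟨⟨h1.trans hz.1.1, hz.1.2.trans h2⟩, hz.2.1, hz.2.2⟩

/-- The piece of a band representation over the base sub-interval `[lo, hi]`. -/
def GB (R : KZ.IntegralRep 2) (L U : Edge) (hR : R.domain = sbDom L U) (lo hi : ℚ)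
    (hlo : 0 ≤ lo) (hhi : hi ≤ 1) : KZ.IntegralRep 2 :=
  R.restrict (gband lo hi L U) (isSemialgebraic_gband lo hi hlo hhi L U)
    (by rw [hR]; exact gband_subset lo hi hlo hhi L U)

/-- `GB_domain`: auxiliary theorem of the lens-6 g8e development GoldenPair10 (census pair #10; instances of 28994/4280) — see the module docstring; verbatim from the lens file. -/
@[simp] theorem GB_domain (R : KZ.IntegralRep 2) (L U : Edge) (hR lo hi hlo hhi) :
    (GB R L U hR lo hi hlo hhi).domain = gband lo hi L U := rfl
/-- `GB_integrand`: auxiliary theorem of the lens-6 g8e development GoldenPair10 (census pair #10; instances of 28994/4280) — see the module docstring; verbatim from the lens file. -/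
@[simp] theorem GB_integrand (R : KZ.IntegralRep 2) (L U : Edge) (hR lo hi hlo hhi) :
    (GB R L U hR lo hi hlo hhi).integrand = R.integrand := rfl

/-- **(base cut, general band)** additivity along the vertical line `t = q` (rule 1a). -/
theorem gcut (R : KZ.IntegralRep 2) (L U : Edge) (hR : R.domain = sbDom L U) (q : ℚ)
    (hq0 : 0 ≤ q) (hq1 : q ≤ 1) :
    KZ.of R - KZ.of (GB R L U hR 0 q le_rfl hq1) - KZ.of (GB R L U hR q 1 hq0 le_rfl) ∈ KZ.relations := by
  refine KZ.domainAddRel_subset_relations ⟨2, R, GB R L U hR 0 q le_rfl hq1, GB R L U hR q 1 hq0 le_rfl,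
    ?_, ?_, fun z _ => rfl, fun z _ => rfl, rfl⟩
  · rw [hR]
    ext z
    simp only [GB_domain, mem_union, mem_sbDom, mem_gband, Rat.cast_zero, Rat.cast_one]
    constructor
    · rintro ⟨⟨h0, h0'⟩, h1, h2⟩
      rcases le_total (z 0) (q : ℝ) with h | h
      · exact Or.inl ⟨⟨h0, h⟩, h1, h2⟩
      · exact Or.inr ⟨⟨h, h0'⟩, h1, h2⟩
    · have hq0' : (0 : ℝ) ≤ q := by exact_mod_cast hq0
      have hq1' : (q : ℝ) ≤ 1 := by exact_mod_cast hq1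
      rintro (⟨⟨h0, h0'⟩, h1, h2⟩ | ⟨⟨h0, h0'⟩, h1, h2⟩)
      · exact ⟨⟨h0, h0'.trans hq1'⟩, h1, h2⟩
      · exact ⟨⟨hq0'.trans h0, h0'⟩, h1, h2⟩
  · refine measure_mono_null (fun z hz => ?_) (volume_vline (q : ℝ))
    have h1 : z ∈ gband 0 q L U := hz.1
    have h2 : z ∈ gband q 1 L U := hz.2
    rw [mem_gband] at h1 h2
    exact le_antisymm h1.1.2 h2.1.1

/-! ### A planar affine change of variables with rational coefficients (rule 2) -/

end Summit.KontsevichZagierPeriods.RootDecompQuadraticDescent.GoldenPair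

end
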